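import Summits.PneNP.PneNP.Theorems.SymmetryBudgetWindowBarrierEntropyGameSize
import Literature.ModelTheory.FiniteModelTheory.CkEquiv
import Mathlib.Combinatorics.Hall.Basic

/-!
# The pebble content of the entropy game
(dichotomy `WindowBarrier` stmt-PneNP-2145 / `NoHiddenOrder` stmt-PneNP-14781, route `PneNP/SymmetryBudget`)

An entropy-`K` game contains Hella's bijective `k`-pebble game for every `k` with
`n! ≤ 2^{Kn} (n-k)!` (e.g. `k = K n / (log₂ n + 1)`): the types "`k` singletons and one block" are
low-entropy, a position of such a type is a pebble position, the block clause towards the type with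
one more singleton is a bijective pebble move (a vertex bijection is extracted from the bijection of
the block group by Hall's theorem), and the point clause makes positions partial isomorphisms.

* `CosetGame.pebMu I` — the labelling with singleton classes `I`; `CosetGame.isLowEntropy_pebMu`.
* **`CosetGame.ckEquiv_of_relInf`**, **`CosetGame.ckEquiv_of_entropyGame`** —
  `Nonempty (EntropyGame K G H) → CkEquiv k G H` whenever `n! ≤ 2^{Kn} (n-k)!`;
  `CosetGame.ckEquiv_of_entropyGame_log` — the instance `k = K n / (log₂ n + 1)`.
* **`CosetGame.ckEquiv_of_hardToIdentify`** — HardToIdentify (the open core of stmt-PneNP-2145) forces,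
  for every `K`, infinitely many non-isomorphic pairs that are `C^{K n /(log₂ n + 1)}`-equivalent
  (through `hardToIdentify_iff_entropyGames`): the pebble/Weisfeiler–Leman part of any witness family
  is necessary but — CFI pairs being separated by one bipartition — not sufficient.
-/

-- `Summit.PneNP.PneNP.…` duplicates `PneNP` BY DESIGN (single-problem summit).
set_option linter.dupNamespace false

namespace Summit.PneNP.PneNP.Theorems

open Finset Filter Literature.Computability.Complexity Literature.ModelTheory.FiniteModelTheory
open scoped Classical

namespace CosetGame

variable {n K : ℕ}

noncomputable section

/-! ### Pebble types -/

/-- The labelling "singletons at `I`, one block elsewhere". -/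
def pebMu (I : Finset (Fin n)) : Fin n → ℕ := fun i => if i ∈ I then (i : ℕ) + 1 else 0

/-- Pebbled slots carry their own label. -/
theorem pebMu_of_mem {I : Finset (Fin n)} {i : Fin n} (h : i ∈ I) : pebMu I i = (i : ℕ) + 1 := if_pos h

/-- Unpebbled slots carry the label `0`. -/
theorem pebMu_of_not_mem {I : Finset (Fin n)} {i : Fin n} (h : i ∉ I) : pebMu I i = 0 := if_neg h

/-- The label `0` marks the big block. -/
theorem pebMu_eq_zero_iff {I : Finset (Fin n)} {i : Fin n} : pebMu I i = 0 ↔ i ∉ I := by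
  by_cases h : i ∈ I
  · rw [pebMu_of_mem h]; simp [h]
  · rw [pebMu_of_not_mem h]; simp [h]

/-- No pebbles: the one-block labelling. -/
theorem pebMu_empty : pebMu (∅ : Finset (Fin n)) = fun _ => 0 :=
  funext fun i => pebMu_of_not_mem (Finset.notMem_empty i)

/-- Elements of the block group of a pebble type fix the pebbled slots. -/
theorem apply_eq_of_mem_blockGroup_pebMu {I : Finset (Fin n)} {ρ : Equiv.Perm (Fin n)}
    (hρ : ρ ∈ blockGroup (pebMu I)) {i : Fin n} (hi : i ∈ I) : ρ i = i := by
  obtain ⟨hc, -⟩ := (mem_evenStab_iff _ _).1 (blockGroup_le_evenStab _ hρ)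
  have h := (mem_classStab_iff _ _).1 hc i
  rw [pebMu_of_mem hi] at h
  have hmem : ρ i ∈ I := by
    by_contra hn
    rw [pebMu_of_not_mem hn] at h
    exact Nat.succ_ne_zero _ h.symm
  rw [pebMu_of_mem hmem] at h
  exact Fin.ext (by omega)

/-- The big block of a pebble type has `n - |I|` slots. -/
theorem card_filter_pebMu_eq_zero (I : Finset (Fin n)) :
    (univ.filter fun u : Fin n => pebMu I u = 0).card = n - I.card := by
  have h : (univ.filter fun u : Fin n => pebMu I u = 0) = univ \ I := by
    ext u; simp [pebMu_eq_zero_iff]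
  rw [h, Finset.card_univ_sdiff, Fintype.card_fin]

/-- **Pebble types are low-entropy** as soon as `n! ≤ 2^{Kn} (n - |I|)!`. -/
theorem isLowEntropy_pebMu {I : Finset (Fin n)} (h : n.factorial ≤ 2 ^ (K * n) * (n - I.card).factorial) :
    IsLowEntropy K (pebMu I) := by
  unfold IsLowEntropy
  refine h.trans (Nat.mul_le_mul_left _ ?_)
  have hpos : 0 < ∏ i ∈ univ.image (pebMu I), ((univ.filter fun u : Fin n => pebMu I u = i).card).factorial :=
    Finset.prod_pos fun i _ => Nat.factorial_pos _
  by_cases h0 : (0 : ℕ) ∈ univ.image (pebMu I)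
  · have hd : ((univ.filter fun u : Fin n => pebMu I u = 0).card).factorial ∣
        ∏ i ∈ univ.image (pebMu I), ((univ.filter fun u : Fin n => pebMu I u = i).card).factorial :=
      Finset.dvd_prod_of_mem (fun i => ((univ.filter fun u : Fin n => pebMu I u = i).card).factorial) h0
    rw [card_filter_pebMu_eq_zero] at hd
    exact Nat.le_of_dvd hpos hd
  · -- no big block: every slot is pebbled, `n - |I| = 0`
    have hI : I = univ := by
      ext i
      simp only [Finset.mem_univ, iff_true]
      by_contra hi
      exact h0 (Finset.mem_image.2 ⟨i, Finset.mem_univ _, pebMu_of_not_mem hi⟩)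
    subst hI
    rw [Finset.card_univ, Fintype.card_fin, Nat.sub_self, Nat.factorial_zero]
    exact hpos

/-! ### Moves of the limit refinement -/

/-- **A block move of the limit**: one bijection of `A` that works at every round (pigeonhole). -/
theorem RelInf.step {A B : Subgroup (Equiv.Perm (Fin n))} (hB : IsType K B) {G H : SimpleGraph (Fin n)}
    {β γ : Equiv.Perm (Fin n)} (h : RelInf K A G β H γ) :
    ∃ e : A ≃ A, ∀ ρ : A, RelInf K B G (β * ρ) H (γ * e ρ) := by
  have hstep : ∀ r, ∃ e : A ≃ A, ∀ ρ : A, Rel K r B G (β * ρ) H (γ * e ρ) := fun r =>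
    (h (r + 1)).2.1 B hB
  obtain ⟨e, he⟩ := exists_equiv_forall (fun r (ρ ρ' : A) => Rel K r B G (β * ρ) H (γ * ρ'))
    (fun r ρ ρ' h => h.1) hstep
  exact ⟨e, fun ρ r => he r ρ⟩

/-- **The point clause of the limit at pebbled slots**: pebbled pairs span a partial isomorphism. -/
theorem RelInf.adj_iff {I : Finset (Fin n)} {G H : SimpleGraph (Fin n)} {β γ : Equiv.Perm (Fin n)}
    (h : RelInf K (blockGroup (pebMu I)) G β H γ) {i j : Fin n} (hi : i ∈ I) (hj : j ∈ I) :
    G.Adj (β i) (β j) ↔ H.Adj (γ i) (γ j) := by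
  obtain ⟨e, he⟩ := (h 1).2.2 (i, j)
  have h1 := he 1
  simp only [OneMemClass.coe_one, mul_one, Equiv.Perm.mul_apply] at h1
  rwa [apply_eq_of_mem_blockGroup_pebMu (e 1).2 hi, apply_eq_of_mem_blockGroup_pebMu (e 1).2 hj] at h1

/-! ### The pebble strategy -/

section Strategy

variable (K) (k : ℕ) (G H : SimpleGraph (Fin n))

/-- The pebble positions read off the limit refinement: images of the pebbled slots of a pebble type
under a related pair of positions. -/
def pebCarrier : Set (Set (Fin n × Fin n)) :=
  {p | ∃ I : Finset (Fin n), I.card ≤ k ∧ ∃ β γ : Equiv.Perm (Fin n),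
    p = ((I.image fun i => (β i, γ i) : Finset (Fin n × Fin n)) : Set (Fin n × Fin n)) ∧
      RelInf K (blockGroup (pebMu I)) G β H γ}

variable {K k G H}

/-- The pebble map of a position is injective on slots. -/
theorem pebPair_injective (β γ : Equiv.Perm (Fin n)) : Function.Injective fun i : Fin n => (β i, γ i) :=
  fun _ _ h => β.injective (Prod.ext_iff.1 h).1

/-- Positions are partial isomorphisms. -/
theorem isPartialIso_of_mem_pebCarrier {p : Set (Fin n × Fin n)} (hp : p ∈ pebCarrier K k G H) :
    IsPartialIso G H p := by
  obtain ⟨I, -, β, γ, rfl, hR⟩ := hp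
  refine ⟨fun x hx y hy => ?_, fun x hx y hy => ?_⟩
  · obtain ⟨i, -, rfl⟩ := Finset.mem_image.1 (Finset.mem_coe.1 hx)
    obtain ⟨j, -, rfl⟩ := Finset.mem_image.1 (Finset.mem_coe.1 hy)
    exact β.injective.eq_iff.trans γ.injective.eq_iff.symm
  · obtain ⟨i, hi, rfl⟩ := Finset.mem_image.1 (Finset.mem_coe.1 hx)
    obtain ⟨j, hj, rfl⟩ := Finset.mem_image.1 (Finset.mem_coe.1 hy)
    show G.Adj (β i) (β j) ↔ H.Adj (γ i) (γ j)
    exact RelInf.adj_iff hR hi hj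

/-- Sub-positions are positions (lift pebbles: block move to the sub-type, at `ρ = 1`). -/
theorem mem_pebCarrier_of_subset (hk : n.factorial ≤ 2 ^ (K * n) * (n - k).factorial)
    {p : Set (Fin n × Fin n)} (hp : p ∈ pebCarrier K k G H) {q : Set (Fin n × Fin n)} (hq : q ⊆ p) :
    q ∈ pebCarrier K k G H := by
  obtain ⟨I, hI, β, γ, rfl, hR⟩ := hp
  set J : Finset (Fin n) := I.filter fun i => (β i, γ i) ∈ q with hJ
  have hJI : J ⊆ I := Finset.filter_subset _ _
  have hJk : J.card ≤ k := (Finset.card_le_card hJI).trans hI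
  -- the sub-type is a type
  have hT : IsType K (blockGroup (pebMu J)) :=
    isType_blockGroup (isLowEntropy_pebMu (hk.trans (Nat.mul_le_mul_left _
      (Nat.factorial_le (Nat.sub_le_sub_left hJk n)))))
  obtain ⟨e, he⟩ := RelInf.step hT hR
  refine ⟨J, hJk, _, _, ?_, he 1⟩
  ext x
  constructor
  · intro hx
    obtain ⟨i, hi, rfl⟩ := Finset.mem_image.1 (Finset.mem_coe.1 (hq hx))
    refine Finset.mem_coe.2 (Finset.mem_image.2 ⟨i, Finset.mem_filter.2 ⟨hi, hx⟩, ?_⟩)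
    simp only [OneMemClass.coe_one, mul_one, Equiv.Perm.mul_apply]
    rw [apply_eq_of_mem_blockGroup_pebMu (e 1).2 hi]
  · intro hx
    obtain ⟨i, hi, rfl⟩ := Finset.mem_image.1 (Finset.mem_coe.1 hx)
    obtain ⟨hiI, hiq⟩ := Finset.mem_filter.1 hi
    simp only [OneMemClass.coe_one, mul_one, Equiv.Perm.mul_apply]
    rwa [apply_eq_of_mem_blockGroup_pebMu (e 1).2 hiI]

/-- **Fibres of the move multigraph are uniform.**  For a family `F s` of bijections of `A`, the pairs
`(s, ρ)` with `β ((F s ρ) s) = a` number exactly `|A|`. -/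
theorem card_filter_apply_eq (A : Subgroup (Equiv.Perm (Fin n))) (β : Equiv.Perm (Fin n)) (F : Fin n → A ≃ A)
    (a : Fin n) :
    (univ.filter fun x : Fin n × A => β (((F x.1 x.2 : A) : Equiv.Perm (Fin n)) x.1) = a).card = Fintype.card A := by
  rw [← Fintype.card_subtype]
  calc Fintype.card {x : Fin n × A // β (((F x.1 x.2 : A) : Equiv.Perm (Fin n)) x.1) = a}
      = Fintype.card {x : Fin n × A // β ((x.2 : Equiv.Perm (Fin n)) x.1) = a} :=
        Fintype.card_congr (((Equiv.refl (Fin n)).prodShear F).subtypeEquiv fun _ => Iff.rfl)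
    _ = Fintype.card A := by
        -- `(s, ρ) ↦ ρ` is a bijection from the fibre onto `A` (the slot is `ρ⁻¹ (β⁻¹ a)`)
        refine Fintype.card_congr
          { toFun := fun x => x.1.2
            invFun := fun ρ => ⟨(((ρ : Equiv.Perm (Fin n)))⁻¹ (β⁻¹ a), ρ), by simp⟩
            left_inv := ?_
            right_inv := fun ρ => rfl }
        rintro ⟨⟨s, ρ⟩, hx⟩
        have hs : ((ρ : Equiv.Perm (Fin n)))⁻¹ (β⁻¹ a) = s := by
          rw [← hx]; simp
        exact Subtype.ext (Prod.ext hs rfl)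

/-- **The bijective forth property** (Hall on the `|A|`-regular move multigraph). -/
theorem forth_pebCarrier (hk : n.factorial ≤ 2 ^ (K * n) * (n - k).factorial)
    {p : Set (Fin n × Fin n)} (hp : p ∈ pebCarrier K k G H) (hpk : p.ncard < k) :
    ∃ f : Fin n ≃ Fin n, ∀ a : Fin n, insert (a, f a) p ∈ pebCarrier K k G H := by
  obtain ⟨I, -, β, γ, rfl, hR⟩ := hp
  rw [Set.ncard_coe_finset, Finset.card_image_of_injective _ (pebPair_injective β γ)] at hpk
  set A : Subgroup (Equiv.Perm (Fin n)) := blockGroup (pebMu I) with hA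
  -- one block move per new pebble slot
  have hT : ∀ s : Fin n, IsType K (blockGroup (pebMu (insert s I))) := fun s =>
    isType_blockGroup (isLowEntropy_pebMu (hk.trans (Nat.mul_le_mul_left _ (Nat.factorial_le
      (Nat.sub_le_sub_left ((Finset.card_insert_le s I).trans (Nat.succ_le_of_lt hpk)) n)))))
  choose e he using fun s : Fin n => RelInf.step (hT s) hR
  -- the move multigraph: `(s, ρ)` joins `β (ρ s)` to `γ ((e s ρ) s)`
  let src : Fin n × A → Fin n := fun x => β ((x.2 : Equiv.Perm (Fin n)) x.1)
  let tgt : Fin n × A → Fin n := fun x => γ (((e x.1 x.2 : A) : Equiv.Perm (Fin n)) x.1)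
  let t : Fin n → Finset (Fin n) := fun a => univ.filter fun b => ∃ x, src x = a ∧ tgt x = b
  have hsrc : ∀ a, (univ.filter fun x => src x = a).card = Fintype.card A := fun a =>
    card_filter_apply_eq A β (fun _ => Equiv.refl A) a
  have htgt : ∀ b, (univ.filter fun x => tgt x = b).card = Fintype.card A := fun b =>
    card_filter_apply_eq A γ e b
  have hApos : 0 < Fintype.card A := Fintype.card_pos
  -- Hall's condition by double counting
  have hall : ∀ X : Finset (Fin n), X.card ≤ (X.biUnion t).card := by
    intro X
    have hsub : (univ.filter fun x => src x ∈ X) ⊆ univ.filter fun x => tgt x ∈ X.biUnion t := by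
      intro x hx
      simp only [Finset.mem_filter, Finset.mem_univ, true_and] at hx ⊢
      exact Finset.mem_biUnion.2 ⟨src x, hx, Finset.mem_filter.2 ⟨Finset.mem_univ _, x, rfl, rfl⟩⟩
    have h1 : (univ.filter fun x => src x ∈ X).card = X.card * Fintype.card A := by
      rw [Finset.card_eq_sum_card_fiberwise (f := src) (s := univ.filter fun x => src x ∈ X) (t := X)
        fun x hx => Finset.mem_coe.2 (Finset.mem_filter.1 (Finset.mem_coe.1 hx)).2,
        Finset.sum_const_nat (m := Fintype.card A)]
      intro a ha
      rw [← hsrc a, Finset.filter_filter]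
      exact congrArg Finset.card (Finset.filter_congr fun x _ => ⟨fun h => h.2, fun h => ⟨by rw [h]; exact ha, h⟩⟩)
    have h2 : (univ.filter fun x => tgt x ∈ X.biUnion t).card = (X.biUnion t).card * Fintype.card A := by
      rw [Finset.card_eq_sum_card_fiberwise (f := tgt) (s := univ.filter fun x => tgt x ∈ X.biUnion t)
        (t := X.biUnion t) fun x hx => Finset.mem_coe.2 (Finset.mem_filter.1 (Finset.mem_coe.1 hx)).2,
        Finset.sum_const_nat (m := Fintype.card A)]
      intro b hb
      rw [← htgt b, Finset.filter_filter]
      exact congrArg Finset.card (Finset.filter_congr fun x _ => ⟨fun h => h.2, fun h => ⟨by rw [h]; exact hb, h⟩⟩)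
    have := Finset.card_le_card hsub
    rw [h1, h2] at this
    exact Nat.le_of_mul_le_mul_right this hApos
  obtain ⟨f, hf, hft⟩ := (Finset.all_card_le_biUnion_card_iff_exists_injective t).1 hall
  refine ⟨Equiv.ofBijective f hf.bijective_of_finite, fun a => ?_⟩
  obtain ⟨⟨s, ρ⟩, hs, hb⟩ := (Finset.mem_filter.1 (hft a)).2
  simp only [Equiv.ofBijective_apply]
  refine ⟨insert s I, (Finset.card_insert_le s I).trans (Nat.succ_le_of_lt hpk), _, _, ?_, he s ρ⟩
  rw [Finset.image_insert, Finset.coe_insert]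
  congr 1
  · simp only [Equiv.Perm.mul_apply]
    exact Prod.ext hs.symm hb.symm
  · congr 1
    refine Finset.image_congr fun i hi => ?_
    simp only [Equiv.Perm.mul_apply]
    rw [apply_eq_of_mem_blockGroup_pebMu ρ.2 hi, apply_eq_of_mem_blockGroup_pebMu (e s ρ).2 hi]

/-- **The pebble strategy of a limit-related pair of one-block positions.** -/
def pebStrategy (hk : n.factorial ≤ 2 ^ (K * n) * (n - k).factorial) {β γ : Equiv.Perm (Fin n)}
    (h : RelInf K (blockGroup fun _ : Fin n => 0) G β H γ) : BijPebbleStrategy k G H where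
  carrier := pebCarrier K k G H
  empty_mem := ⟨∅, by simp, β, γ, by simp, by rwa [pebMu_empty]⟩
  finite_of_mem := by
    rintro p ⟨I, -, β, γ, rfl, -⟩
    exact Finset.finite_toSet _
  ncard_le_of_mem := by
    rintro p ⟨I, hI, β, γ, rfl, -⟩
    rw [Set.ncard_coe_finset]
    exact Finset.card_image_le.trans hI
  isPartialIso_of_mem := fun _ hp => isPartialIso_of_mem_pebCarrier hp
  mem_of_subset := fun _ hp _ hq => mem_pebCarrier_of_subset hk hp hq
  forth := fun _ hp hpk => forth_pebCarrier hk hp hpk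

end Strategy

/-! ### The theorems -/

/-- **Pebble content of the limit refinement.** -/
theorem ckEquiv_of_relInf {k : ℕ} (hk : n.factorial ≤ 2 ^ (K * n) * (n - k).factorial)
    {G H : SimpleGraph (Fin n)} {β γ : Equiv.Perm (Fin n)}
    (h : RelInf K (blockGroup fun _ : Fin n => 0) G β H γ) : CkEquiv k G H :=
  ⟨pebStrategy hk h⟩

/-- **Pebble content of the entropy game**: an entropy-`K` game wins the bijective `k`-pebble game
whenever `n! ≤ 2^{Kn} (n-k)!`. -/
theorem ckEquiv_of_entropyGame {k : ℕ} (hk : n.factorial ≤ 2 ^ (K * n) * (n - k).factorial)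
    {G H : SimpleGraph (Fin n)} (g : Nonempty (EntropyGame K G H)) : CkEquiv k G H := by
  obtain ⟨β, γ, h⟩ := (nonempty_entropyGame_iff K G H).1 g
  exact ckEquiv_of_relInf hk h

/-- The entropy of `k = K n / (log₂ n + 1)` pebbles is at most `K n`: `n! ≤ 2^{Kn} (n-k)!`. -/
theorem factorial_le_two_pow_mul_factorial (n K : ℕ) :
    n.factorial ≤ 2 ^ (K * n) * (n - K * n / (Nat.log 2 n + 1)).factorial := by
  set k := K * n / (Nat.log 2 n + 1) with hk
  set j := min k n with hj
  have hjn : j ≤ n := min_le_right _ _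
  have hsub : n - k = n - j := by omega
  have h1 : n.factorial = (n - j).factorial * n.descFactorial j := (Nat.factorial_mul_descFactorial hjn).symm
  have h2 : n.descFactorial j ≤ 2 ^ (K * n) := by
    calc n.descFactorial j ≤ n ^ j := Nat.descFactorial_le_pow n j
      _ ≤ (2 ^ (Nat.log 2 n + 1)) ^ j := Nat.pow_le_pow_left (Nat.lt_pow_succ_log_self one_lt_two n).le j
      _ = 2 ^ ((Nat.log 2 n + 1) * j) := by rw [← pow_mul]
      _ ≤ 2 ^ (K * n) := Nat.pow_le_pow_right two_pos ?_
    calc (Nat.log 2 n + 1) * j ≤ (Nat.log 2 n + 1) * k := Nat.mul_le_mul_left _ (min_le_left _ _)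
      _ = k * (Nat.log 2 n + 1) := mul_comm _ _
      _ ≤ K * n := by rw [hk]; exact Nat.div_mul_le_self (K * n) (Nat.log 2 n + 1)
  rw [hsub, h1]
  calc (n - j).factorial * n.descFactorial j ≤ (n - j).factorial * 2 ^ (K * n) := Nat.mul_le_mul_left _ h2
    _ = 2 ^ (K * n) * (n - j).factorial := mul_comm _ _

/-- **Pebble content, logarithmic form**: an entropy-`K` game wins the bijective `K n / (log₂ n + 1)`-pebble
game. -/
theorem ckEquiv_of_entropyGame_log {G H : SimpleGraph (Fin n)} (g : Nonempty (EntropyGame K G H)) :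
    CkEquiv (K * n / (Nat.log 2 n + 1)) G H :=
  ckEquiv_of_entropyGame (factorial_le_two_pow_mul_factorial n K) g

/-- **HardToIdentify forces high-dimensional Weisfeiler–Leman equivalence**: for every `K`, infinitely often,
two non-isomorphic `n`-vertex graphs are `C^{K n /(log₂ n + 1)}`-equivalent. -/
theorem ckEquiv_of_hardToIdentify
    (hHTI : ∀ c : ℕ, ∃ᶠ h in atTop, ∃ H : SimpleGraph (Fin h),
      ¬ HasSymCircuit tcBasis Set.univ (2 ^ (c * h))
        (fun x : Fin h × Fin h → Bool =>
          decide (Nonempty ((SimpleGraph.fromRel fun u v => x (u, v) = true) ≃g H))))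
    (K : ℕ) :
    ∃ᶠ n in atTop, ∃ G H : SimpleGraph (Fin n), ¬ Nonempty (G ≃g H) ∧ CkEquiv (K * n / (Nat.log 2 n + 1)) G H :=
  (hardToIdentify_iff_entropyGames.1 hHTI K).mono fun _ ⟨G, H, hGH, g⟩ =>
    ⟨G, H, hGH, ckEquiv_of_entropyGame_log g⟩

end

end CosetGame

end Summit.PneNP.PneNP.Theorems
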